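import Summits.QuantumFields.YangMills.Theorems.BalabanUVNodesK0RecordFormatNamesLemmas

/-!
# K0⁷ — THE RECORD-SIDE FORMAT NAMES (WORLD A), LEMMA FILE 2: the two-block `(𝐔, 𝐉)` layer of edition 7 (CRIT-1's (R-J) ruling) — the structural
# half of 27932⁗ at the `…J` names (convex ∕ balanced ∕ open ∕ `0 ∈`), `Chart44DAtJ` IS typer-1's `Chart44D`, NamesAgree′ ∕ ROW Gk faces, the flat point, radii

Cell `ym-nodeO-ideate`, DEFINER seat `ym-nodeO-def-1` (gen 33); second lemma sibling (the first, `…Lemmas`, is at the 400-line cap); `--kind proof --supports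
stmt-QuantumFields-20541 --as helper`; count-neutral.  [I] = [Balaban1987RG1].

CONTENTS.  §1 `chartMatULM ∕ chartMatJcLM` (the two blocks as linear maps), `recordDom44J_eq_iInter`, ★ `convex_balanced_isOpen_recordDom44J`, ★ `zero_mem_recordDom44J`
— four of the six conjuncts of `Chart44DAtJ` (the repaired, print-faithful 27932⁗) discharged outright.  §2 `chart44DAtJ_iff` (`Iff.rfl` to the tree's `B12FormatPlus.Chart44D`),
`recordResponse9DataJ_namesAgree` ∕ `…FromJ_namesAgree` (`⟨rfl, rfl, rfl⟩`), `recordResponse9DataJ_Gk` (ROW Gk, `rfl`), `decodeCfg_recordChartJ_zero` (the two-block chart origin is the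
unit pair `(1, 0)`), `recordR_eq_cast_recordRNat`, `recordRNat_le`.  §3 (v2) ★ `recordChartJ_inputLocal` = ROW (A3) for the two-block chart, PROVED.  §4 (v3) ★ `recordRho_recordE_window` = ROW (W-metric)
at the names (`ρ (e μ 0) (e ν z) = l1 z` on the window `2|z_i| < N`), PROVED via `min_val_neg_val_intCast`.  §5 (v4, ref-H nit (a)) ★ `isTDom_image_liftCubeCtr` ∕ `recordDomEmbCtr_val_of_not_mem`: OFF THE WRAP CLASS the
CENTRED domain embedding IS the lifted cube family (wall-adjacency preserved by `valMinAbs` off the antipodal value; `Relation.ReflTransGen.lift`).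

HONEST FRAMING.  Bookkeeping about NAMES; nothing of Bałaban's estimates asserted, ported or discharged; texts OPEN (27930⁷∕27932⁗∕27931⁵ to be cut over the `…J` names);
K0⁷ NOT closed; NODE O 0∕1; COUNT 8∕28 · K 1∕4 UNMOVED; finite `𝕋⁴_{L^K}` at fixed ε — NOT continuum ∕ ℝ⁴ ∕ OS; **the Yang–Mills mass gap (Clay) is NOT proved by any of this.**
No `sorry`; standard axioms.
-/

noncomputable section

open scoped BigOperators Matrix.Norms.L2Operator

namespace Summit.QuantumFields.YangMills.Theorems.K0RecordFormatNames

open Literature.MathematicalPhysics.QuantumFieldTheory.Balaban1983to89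
open Literature.MathematicalPhysics.QuantumFieldTheory.Balaban1983to89.Node00
open Literature.MathematicalPhysics.QuantumFieldTheory.Balaban1983to89.T4Continuum (T4Family)
open Literature.MathematicalPhysics.QuantumFieldTheory.Balaban1983to89.TreeLengthTorus (TPt TAdj TStepIn TLinked TFaceConnected IsTDom)
open NormedSpace (exp)

variable (F : T4Family)

/-! ## §1  The two-block (4.4) domain `recordDom44J` is CONVEX, BALANCED, OPEN and contains `0` -/

/-- `w ↦ chartMatU F K w b` as a `ℂ`-linear map. [cite: Balaban1987RG1, (1.9) p.261 (bookkeeping)] -/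
def chartMatULM (K : ℕ) (b : PBond (F.P K) 0) : (Fin (recordChartDimJ F K) → ℂ) →ₗ[ℂ] MatA 2 where
  toFun w := chartMatU F K w b
  map_add' w w' := by simp [chartMatU, add_smul, Finset.sum_add_distrib]
  map_smul' c w := by simp [chartMatU, Finset.smul_sum, smul_smul]

/-- `w ↦ chartMatJc F K w b` as a `ℂ`-linear map. [cite: Balaban1987RG1, (1.9) p.261 (bookkeeping)] -/
def chartMatJcLM (K : ℕ) (b : PBond (F.P K) 0) : (Fin (recordChartDimJ F K) → ℂ) →ₗ[ℂ] MatA 2 where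
  toFun w := chartMatJc F K w b
  map_add' w w' := by simp [chartMatJc, add_smul, Finset.sum_add_distrib]
  map_smul' c w := by simp [chartMatJc, Finset.smul_sum, smul_smul]

/-- `chartMatULM` evaluates to `chartMatU`. [cite: Balaban1987RG1, (1.9) p.261 (bookkeeping)] -/
@[simp] theorem chartMatULM_apply (K : ℕ) (b : PBond (F.P K) 0) (w : Fin (recordChartDimJ F K) → ℂ) : chartMatULM F K b w = chartMatU F K w b := rfl

/-- `chartMatJcLM` evaluates to `chartMatJc`. [cite: Balaban1987RG1, (1.9) p.261 (bookkeeping)] -/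
@[simp] theorem chartMatJcLM_apply (K : ℕ) (b : PBond (F.P K) 0) (w : Fin (recordChartDimJ F K) → ℂ) : chartMatJcLM F K b w = chartMatJc F K w b := rfl

/-- A strict norm sublevel set of a linear map of the two-block coordinates is convex, balanced and open (finite dimensions). [folklore] -/
theorem convex_balanced_isOpen_normLtJ {K : ℕ} (L : (Fin (recordChartDimJ F K) → ℂ) →ₗ[ℂ] MatA 2) (r : ℝ) :
    Convex ℝ {w : Fin (recordChartDimJ F K) → ℂ | ‖L w‖ < r} ∧ Balanced ℂ {w : Fin (recordChartDimJ F K) → ℂ | ‖L w‖ < r} ∧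
      IsOpen {w : Fin (recordChartDimJ F K) → ℂ | ‖L w‖ < r} := by
  refine ⟨?_, ?_, isOpen_lt (continuous_norm.comp L.continuous_of_finiteDimensional) continuous_const⟩
  · have h : {w : Fin (recordChartDimJ F K) → ℂ | ‖L w‖ < r} = (L.restrictScalars ℝ) ⁻¹' Metric.ball 0 r := by
      ext w; simp
    rw [h]
    exact (convex_ball 0 r).linear_preimage _
  · intro a ha
    rintro _ ⟨w, hw, rfl⟩
    have hw' : ‖L w‖ < r := hw
    show ‖L (a • w)‖ < r
    rw [map_smul, norm_smul]
    exact (mul_le_of_le_one_left (norm_nonneg _) ha).trans_lt hw'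

/-- `recordDom44J` as a finite intersection of guarded strict norm sublevel sets of linear maps (three `𝐔`-families and the `𝐉`-family).
[cite: Balaban1987RG1, (4.4) p.281, (1.14) p.262 (bookkeeping)] -/
theorem recordDom44J_eq_iInter (Mc k K : ℕ) (X : (recordDomSys F Mc k K).Dom) (α₂ : ℝ) :
    recordDom44J F Mc k K X α₂ =
      (⋂ b : PBond (F.P K) 0, {w | b ∈ domBonds F Mc k K X → w ∈ {w | ‖chartMatULM F K b w‖ < α₂ * (F.P K).eta (k + 1)}}) ∩
      (⋂ b : PBond (F.P K) 0, ⋂ μ : Fin (F.P K).d, {w | (b ∈ domBonds F Mc k K X ∧ (⟨b.src.shift μ, b.dir⟩ : PBond (F.P K) 0) ∈ domBonds F Mc k K X) →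
        w ∈ {w | ‖(chartMatULM F K ⟨b.src.shift μ, b.dir⟩ - chartMatULM F K b) w‖ < α₂ * (F.P K).eta (k + 1) ^ 2}}) ∩
      (⋂ b : PBond (F.P K) 0, {w | (b ∈ domBonds F Mc k K X ∧ ∀ μ : Fin (F.P K).d, (⟨b.src.shift μ, b.dir⟩ : PBond (F.P K) 0) ∈ domBonds F Mc k K X ∧
          (⟨b.src.unshift μ, b.dir⟩ : PBond (F.P K) 0) ∈ domBonds F Mc k K X) →
        w ∈ {w | ‖(∑ μ : Fin (F.P K).d, (chartMatULM F K ⟨b.src.shift μ, b.dir⟩ - (2 : ℂ) • chartMatULM F K b + chartMatULM F K ⟨b.src.unshift μ, b.dir⟩)) w‖ <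
          α₂ * (F.P K).eta (k + 1) ^ 3}}) ∩
      (⋂ b : PBond (F.P K) 0, {w | b ∈ domBonds F Mc k K X → w ∈ {w | ‖chartMatJcLM F K b w‖ < α₂}}) := by
  ext w
  simp only [recordDom44J, Set.mem_setOf_eq, Set.mem_inter_iff, Set.mem_iInter, chartMatULM_apply, chartMatJcLM_apply, LinearMap.sub_apply, LinearMap.coe_sum,
    Finset.sum_apply, LinearMap.add_apply, LinearMap.smul_apply, and_imp]
  constructor
  · rintro ⟨h1, h2, h3, h4⟩
    exact ⟨⟨⟨h1, fun b μ hb hμ => h2 b hb μ hμ⟩, fun b hb hμ => h3 b hb hμ⟩, h4⟩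
  · rintro ⟨⟨⟨h1, h2⟩, h3⟩, h4⟩
    exact ⟨h1, fun b hb μ hμ => h2 b μ hb hμ, fun b hb hμ => h3 b hb hμ, h4⟩

/-- **`recordDom44J` is CONVEX, BALANCED and OPEN** (three conjuncts of `Chart44DAtJ`, discharged). [cite: Balaban1987RG1, (4.4) p.281, (1.14) p.262] -/
theorem convex_balanced_isOpen_recordDom44J (Mc k K : ℕ) (X : (recordDomSys F Mc k K).Dom) (α₂ : ℝ) :
    Convex ℝ (recordDom44J F Mc k K X α₂) ∧ Balanced ℂ (recordDom44J F Mc k K X α₂) ∧ IsOpen (recordDom44J F Mc k K X α₂) := by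
  rw [recordDom44J_eq_iInter]
  have key : ∀ {c : Prop} (L : (Fin (recordChartDimJ F K) → ℂ) →ₗ[ℂ] MatA 2) (r : ℝ),
      Convex ℝ {w : Fin (recordChartDimJ F K) → ℂ | c → w ∈ {w | ‖L w‖ < r}} ∧ Balanced ℂ {w : Fin (recordChartDimJ F K) → ℂ | c → w ∈ {w | ‖L w‖ < r}} ∧
        IsOpen {w : Fin (recordChartDimJ F K) → ℂ | c → w ∈ {w | ‖L w‖ < r}} :=
    fun L r => convex_balanced_isOpen_imp (convex_balanced_isOpen_normLtJ F L r)
  refine ⟨?_, ?_, ?_⟩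
  · exact (((convex_iInter fun b => (key _ _).1).inter (convex_iInter fun b => convex_iInter fun μ => (key _ _).1)).inter
      (convex_iInter fun b => (key _ _).1)).inter (convex_iInter fun b => (key _ _).1)
  · exact (((balanced_iInter fun b => (key _ _).2.1).inter (balanced_iInter fun b => balanced_iInter fun μ => (key _ _).2.1)).inter
      (balanced_iInter fun b => (key _ _).2.1)).inter (balanced_iInter fun b => (key _ _).2.1)
  · exact (((isOpen_iInter_of_finite fun b => (key _ _).2.2).inter
      (isOpen_iInter_of_finite fun b => isOpen_iInter_of_finite fun μ => (key _ _).2.2)).inter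
      (isOpen_iInter_of_finite fun b => (key _ _).2.2)).inter (isOpen_iInter_of_finite fun b => (key _ _).2.2)

/-- **`0 ∈ recordDom44J` for `α₂ > 0`** (the two-block chart origin = the unit pair lies in print's (4.4)∕(3.14) domain). [cite: Balaban1987RG1, (4.4) p.281] -/
theorem zero_mem_recordDom44J (Mc k K : ℕ) (X : (recordDomSys F Mc k K).Dom) {α₂ : ℝ} (hα : 0 < α₂) :
    (0 : Fin (recordChartDimJ F K) → ℂ) ∈ recordDom44J F Mc k K X α₂ := by
  have hU : ∀ b, chartMatU F K 0 b = 0 := fun b => by simp [chartMatU]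
  have hJ : ∀ b, chartMatJc F K 0 b = 0 := fun b => by simp [chartMatJc]
  have hξ : 0 < (F.P K).eta (k + 1) := by
    unfold Params.eta
    have hL : (0 : ℝ) < (F.P K).L := by exact_mod_cast (F.P K).L_pos
    positivity
  refine ⟨fun b _ => ?_, fun b _ μ _ => ?_, fun b _ _ => ?_, fun b _ => ?_⟩
  · simpa [hU] using mul_pos hα hξ
  · simpa [hU] using mul_pos hα (pow_pos hξ 2)
  · simpa [hU] using mul_pos hα (pow_pos hξ 3)
  · simpa [hJ] using hα

/-! ## §2  Agreement with the tree moulds and the faces of the two-block record instance -/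

/-- **The receipt `Chart44DAtJ` IS typer-1's mould `B12FormatPlus.Chart44D` at the two-block names** (`Iff.rfl`). [cite: Balaban1987RG1, (4.4) p.281 (bookkeeping)] -/
theorem chart44DAtJ_iff (Mc k : ℕ) (α₀ α₁ α₂ : ℝ) :
    Chart44DAtJ F Mc k α₀ α₁ α₂ ↔
      B12FormatPlus.Chart44D (recordDomSys F Mc k) (recordBondCount F) (recordUc F Mc k α₀ α₁) (recordChartDimJ F) (recordChartJ F Mc k)
        (fun K X => recordDom44J F Mc k K X α₂) := Iff.rfl

variable (θ : Stage13Params F 2)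

/-- NamesAgree′ for the two-block record response data (`rfl`): wrap ∕ emb ∕ πc are the CENTRED names 27930⁷ reads. [cite: Balaban1987RG1, (1.7) p.261, (1.21) p.264 (bookkeeping)] -/
theorem recordResponse9DataJ_namesAgree (a : θ.ιβ) (Mc k : ℕ) :
    (recordResponse9DataJ F θ a Mc k).wrap = recordWrapCtr F Mc k ∧ (recordResponse9DataJ F θ a Mc k).emb = recordDomEmbCtr F Mc k ∧
      (recordResponse9DataJ F θ a Mc k).πc = fun K _ => recordCoordProjCtr F K := ⟨rfl, rfl, rfl⟩

/-- NamesAgree′ for the two-block record response data from a base volume (`rfl`). [cite: Balaban1987RG1, (1.7) p.261, (1.21) p.264 (bookkeeping)] -/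
theorem recordResponse9DataFromJ_namesAgree (a : θ.ιβ) (Mc k K₀ : ℕ) :
    (recordResponse9DataFromJ F θ a Mc k K₀).wrap = (fun n => recordWrapCtr F Mc k (K₀ + n)) ∧
      (recordResponse9DataFromJ F θ a Mc k K₀).emb = (fun n => recordDomEmbCtr F Mc k (K₀ + n)) ∧
      (recordResponse9DataFromJ F θ a Mc k K₀).πc = fun n _ => recordCoordProjCtr F (K₀ + n) := ⟨rfl, rfl, rfl⟩

/-- ROW Gk for the two-block record response data (`rfl`). [cite: Balaban1987RG1, (4.35) p.290 (bookkeeping)] -/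
theorem recordResponse9DataJ_Gk (a : θ.ιβ) (Mc k K : ℕ) (l : RespLabel F k K) (i : Fin (recordChartDimJ F K)) :
    (recordResponse9DataJ F θ a Mc k).Gk K l i =
      (letI := θ.instVβ₁; letI := θ.instVβ₂; letI := θ.instιβ
       fderiv ℝ (recordEmbJ F θ k K) 0 (Pi.single l.1 (Pi.single l.2 (θ.bV a))) i) := rfl

/-- **The two-block chart origin is the UNIT PAIR `(𝐔, 𝐉) = (1, 0)`** (the flat point of (4.4)). [cite: Balaban1987RG1, (4.4) p.281] -/
theorem decodeCfg_recordChartJ_zero (Mc k K : ℕ) (X : (recordDomSys F Mc k K).Dom) :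
    decodeCfg F K (recordChartJ F Mc k K X 0) = (fun _ => 1, fun _ => 0) := by
  classical
  have hU : ∀ b, chartMatU F K 0 b = 0 := fun b => by simp [chartMatU]
  have hJ : ∀ b, chartMatJc F K 0 b = 0 := fun b => by simp [chartMatJc]
  simp [recordChartJ, hU, hJ]

/-- The real comparison radius IS the natural one. [cite: Balaban1987RG1, (1.21) p.264 (bookkeeping)] -/
theorem recordR_eq_cast_recordRNat (Mc k K : ℕ) : recordR F Mc k K = (recordRNat F Mc k K : ℝ) := by
  simp [recordR, recordRNat]

/-- The radius never exceeds `Mc ·` (cubes per direction). [cite: Balaban1987RG1, (1.21) p.264 (bookkeeping)] -/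
theorem recordRNat_le (Mc k K : ℕ) : recordRNat F Mc k K ≤ Mc * Sect2.domCount (F.P K) Mc (k + 1) :=
  Nat.mul_le_mul_left _ (Nat.div_le_self _ _)

/-! ## §3  (v2) ROW (A3) at the two-block chart: chart input-locality for `recordChartJ` -/

/-- **ROW (A3) for the two-block chart — CHART INPUT-LOCALITY, proved**: the coordinates in `X` of `recordChartJ … X w` read only the chart inputs in `recordCXJ … X`
(both blocks). [cite: Balaban1987RG1, (1.7) p.261, (4.3) p.281] -/
theorem recordChartJ_inputLocal (Mc k K : ℕ) (X : (recordDomSys F Mc k K).Dom) (u u' : Fin (recordChartDimJ F K) → ℂ)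
    (h : ∀ i ∈ recordCXJ F Mc k K X, u i = u' i) :
    ∀ n ∈ recordCoords F Mc k K X, recordChartJ F Mc k K X u n = recordChartJ F Mc k K X u' n := by
  classical
  intro n hn
  have hU : ∀ b ∈ domBonds F Mc k K X, chartMatU F K u b = chartMatU F K u' b := by
    intro b hb
    refine Finset.sum_congr rfl fun a _ => ?_
    rw [h (chartEquivJ F K (b, Sum.inl a)) (by simpa [recordCXJ] using hb)]
  have hJ : ∀ b ∈ domBonds F Mc k K X, chartMatJc F K u b = chartMatJc F K u' b := by
    intro b hb
    refine Finset.sum_congr rfl fun a _ => ?_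
    rw [h (chartEquivJ F K (b, Sum.inr a)) (by simpa [recordCXJ] using hb)]
  simp only [recordCoords, Finset.mem_filter, Finset.mem_univ, true_and] at hn
  unfold recordChartJ encodeCfg
  rcases hc : ((cfgEquiv F K).symm n).1 with b | b
  · rw [hc] at hn
    simp only [Sum.elim_inl, id] at hn ⊢
    rw [if_pos hn, if_pos hn, hU b hn]
  · rw [hc] at hn
    simp only [Sum.elim_inr, id] at hn ⊢
    rw [if_pos hn, if_pos hn, hJ b hn]

/-! ## §4  (v3) ROW (W-metric) at the names: on the window, the label metric of the two window bonds is `‖z‖₁` -/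

/-- On `ZMod n`, the two torus distances of the residue of an integer `a` with `2|a| < n` from `0` have minimum `|a|`. [folklore] -/
theorem min_val_neg_val_intCast {n : ℕ} [NeZero n] (a : ℤ) (h : 2 * |a| < (n : ℤ)) :
    min ((a : ZMod n)).val ((-(a : ZMod n))).val = a.natAbs := by
  have hv : ((a : ZMod n)).valMinAbs = a := by
    rw [ZMod.valMinAbs_spec]
    have h1 := neg_abs_le a
    have h2 := le_abs_self a
    exact ⟨rfl, Set.mem_Ioc.2 ⟨by linarith, by linarith⟩⟩
  have hmin := ZMod.valMinAbs_natAbs_eq_min (a : ZMod n)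
  rw [hv] at hmin
  rw [hmin, ZMod.neg_val]
  split_ifs with h0
  · have : a = 0 := by rw [← hv, h0, ZMod.valMinAbs_zero]
    subst this
    simp
  · rfl

/-- **ROW (W-metric) AT THE NAMES** (lens-1's `WindowMetric`: `ρ (e μ 0) (e ν z) = l1 z` on the window): for `2|z_i| < N`, the `ℓ¹` torus distance between the
base label's site `0` and the site `−z` is `‖z‖₁`. [cite: Balaban1987RG1, (1.21) p.264] -/
theorem recordRho_recordE_window (k K : ℕ) (μ ν : Fin 4) (z : Fin 4 → ℤ) (hz : ∀ i, 2 * |z i| < (recordN F k K : ℤ)) :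
    recordRho F k K (recordE F k K μ 0) (recordE F k K ν z) = B12Sec2to5.l1 z := by
  unfold recordRho recordE B12Sec2to5.l1 Site.tdist
  simp only [siteOfInt, neg_zero, Pi.zero_apply, Int.cast_zero, zero_sub, sub_zero, Pi.neg_apply, Int.cast_neg, neg_neg]
  rw [Nat.cast_sum]
  refine Fintype.sum_equiv (Fin.castOrderIso (F.P_d K)).toEquiv _ _ fun i => ?_
  have hmin := min_val_neg_val_intCast (n := (F.P K).sitesPerDir (k + 1)) (z (Fin.cast (F.P_d K) i)) (hz _)
  rw [hmin, Nat.cast_natAbs, Int.cast_abs]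
  rfl

/-! ## §5  (v4, ref-H nit (a); 27931 (R3)) THE CENTRED DOMAIN EMBEDDING OFF THE SEAM: the lifted cube family IS wall-connected, so `recordDomEmbCtr` takes its
first branch (no default cube) for every `X ∉ recordWrapCtr` -/

/-- Off the antipodal value, `valMinAbs` commutes with `+1`. [folklore] -/
theorem valMinAbs_add_one_of_ne_half {q : ℕ} [NeZero q] (x : ZMod q) (hx : x.valMinAbs ≠ ((q / 2 : ℕ) : ℤ)) :
    (x + 1).valMinAbs = x.valMinAbs + 1 := by
  have hm := x.valMinAbs_mem_Ioc
  rw [Set.mem_Ioc] at hm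
  refine (ZMod.valMinAbs_spec _ _).2 ⟨by rw [Int.cast_add, Int.cast_one, ZMod.coe_valMinAbs], Set.mem_Ioc.2 ⟨by omega, ?_⟩⟩
  have h2 : x.valMinAbs ≤ ((q / 2 : ℕ) : ℤ) := by omega
  have h3 : x.valMinAbs < ((q / 2 : ℕ) : ℤ) := lt_of_le_of_ne h2 hx
  omega

/-- A cube index is OFF the centred seam iff none of its coordinates is the antipodal value. [cite: Balaban1987RG1, (1.21) p.264 (bookkeeping)] -/
theorem not_onSeamCtr_iff {d n : ℕ} (c : TPt d n) : ¬ OnSeamCtr c ↔ ∀ i, (c i).valMinAbs ≠ ((n / 2 : ℕ) : ℤ) := by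
  simp [OnSeamCtr]

/-- **The centred cube lift preserves `+e_i` steps off the seam.** [cite: Balaban1987RG1, (1.21) p.264] -/
theorem liftCubeCtr_update_add_one (Mc k K : ℕ) (a : TPt (F.P K).d (Sect2.domCount (F.P K) Mc (k + 1))) (i : Fin (F.P K).d)
    (ha : (a i).valMinAbs ≠ ((Sect2.domCount (F.P K) Mc (k + 1) / 2 : ℕ) : ℤ)) :
    liftCubeCtr F Mc k K (Function.update a i (a i + 1)) = Function.update (liftCubeCtr F Mc k K a) i (liftCubeCtr F Mc k K a i + 1) := by
  funext j
  have h := Function.apply_update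
    (fun (_ : Fin (F.P K).d) (x : ZMod (Sect2.domCount (F.P K) Mc (k + 1))) => ((x.valMinAbs : ℤ) : ZMod (Sect2.domCount (F.P (K + 1)) Mc (k + 1))))
    a i (a i + 1) j
  simp only [liftCubeCtr]
  rw [h, valMinAbs_add_one_of_ne_half _ ha, Int.cast_add, Int.cast_one]
  rfl

/-- **The centred cube lift preserves wall-adjacency between OFF-SEAM cubes.** [cite: Balaban1987RG1, (1.21) p.264] -/
theorem tadj_liftCubeCtr (Mc k K : ℕ) {a b : TPt (F.P K).d (Sect2.domCount (F.P K) Mc (k + 1))} (h : TAdj a b)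
    (ha : ¬ OnSeamCtr a) (hb : ¬ OnSeamCtr b) : TAdj (liftCubeCtr F Mc k K a) (liftCubeCtr F Mc k K b) := by
  rw [not_onSeamCtr_iff] at ha hb
  obtain ⟨i, h | h⟩ := h
  · refine ⟨i, Or.inl ?_⟩
    rw [h, liftCubeCtr_update_add_one F Mc k K a i (ha i)]
  · refine ⟨i, Or.inr ?_⟩
    rw [h, liftCubeCtr_update_add_one F Mc k K b i (hb i)]

/-- **OFF THE SEAM THE LIFTED CUBE FAMILY IS A TORUS LOCALIZATION DOMAIN** (non-empty and wall-connected): the `IsTDom` witness `recordDomEmbCtr` branches on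
(ref-H nit (a)). [cite: Balaban1987RG1, p.257 (connected families of cubes), (1.21) p.264] -/
theorem isTDom_image_liftCubeCtr (Mc k K : ℕ) (X : (recordDomSys F Mc k K).Dom) (hX : ∀ c ∈ (X.1 : Finset _), ¬ OnSeamCtr c) :
    IsTDom ((X.1 : Finset _).image (liftCubeCtr F Mc k K)) := by
  classical
  refine ⟨X.2.1.image _, ?_⟩
  intro x hx y hy
  obtain ⟨a, ha, rfl⟩ := Finset.mem_image.1 hx
  obtain ⟨b, hb, rfl⟩ := Finset.mem_image.1 hy
  have hab : TLinked (X.1 : Finset _) a b := X.2.2 a ha b hb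
  unfold TLinked at hab ⊢
  exact Relation.ReflTransGen.lift (liftCubeCtr F Mc k K)
    (fun u v huv => ⟨Finset.mem_image_of_mem _ huv.1, Finset.mem_image_of_mem _ huv.2.1, tadj_liftCubeCtr F Mc k K huv.2.2 (hX u huv.1) (hX v huv.2.1)⟩)
    a b hab

/-- Membership in the centred wrap class. [cite: Balaban1987RG1, (1.21) p.264 (bookkeeping)] -/
theorem mem_recordWrapCtr_iff (Mc k K : ℕ) (X : (recordDomSys F Mc k K).Dom) :
    X ∈ recordWrapCtr F Mc k K ↔ ∃ c ∈ (X.1 : Finset _), OnSeamCtr c := by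
  classical
  simp [recordWrapCtr]

/-- **`recordDomEmbCtr` OFF THE WRAP CLASS IS THE LIFTED FAMILY** (the default branch never fires where the rows read it). [cite: Balaban1987RG1, (1.21) p.264, p.257] -/
theorem recordDomEmbCtr_val_of_not_mem (Mc k K : ℕ) (X : (recordDomSys F Mc k K).Dom) (hX : X ∉ recordWrapCtr F Mc k K) :
    (recordDomEmbCtr F Mc k K X).1 = (X.1 : Finset _).image (liftCubeCtr F Mc k K) := by
  classical
  have h : IsTDom ((X.1 : Finset _).image (liftCubeCtr F Mc k K)) :=
    isTDom_image_liftCubeCtr F Mc k K X fun c hc hs => hX ((mem_recordWrapCtr_iff F Mc k K X).2 ⟨c, hc, hs⟩)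
  unfold recordDomEmbCtr
  rw [dif_pos h]

end Summit.QuantumFields.YangMills.Theorems.K0RecordFormatNames

end
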